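import Literature.AnabelianGeometry.AbsoluteAnabelian.MonoidKummerModel

/-!
# The Kummer map of the model `TM`-pair into `lim→_J H¹(J, Λ(k̄ˣ))` is injective (PROOF-ONLY companion)

Companion of `MonoidKummerModel.lean` (S. Mochizuki, *Topics in absolute anabelian geometry III*, §3,
Prop. 3.2 (ii) p. 71; bib key `MochizukiAbsTopIII2015`, lit key `paper:url-5493eb38cbb7`).  There the
Kummer theory of the model pair `(Π_k ↷ 𝒪_k̄^⊳)` is built (`ModelMLFGaloisData.kummerTheory`) and the
level-`H` Kummer maps `(𝒪_k̄^⊳)^H → H¹(H, Λ(k̄ˣ))` are proved injective whenever `ε_k(H) ⊆ G_k` is open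
(`kummer_injective_of_isOpen`).  This file passes to the direct limit: the Kummer map
`𝒪_k̄^⊳ → lim→_J H¹(J, Λ(k̄ˣ))` of Prop. 3.2 (ii) (`kummerLim`) is INJECTIVE as soon as `ε_k : Π_k ↠ G_k`
is an open map (e.g. `Π_k` profinite, or the mono-analytic model `Π_k = G_k`) — the Kummer-faithfulness
of MLF's ([AbsTopIII] Def. 1.5, Rmk. 1.5.4 (i)) in the packaging of Prop. 3.2 (ii):

* `ContCohomologyData.H1Lim.agree_of_eq` — two classes `[(J, x)] = [(J', x')]` of the direct limit
  `lim→_J H¹(J, ·)` (the quotient `ContCohomologyData.H1Lim` of seat abc-iut-L4-t2's interface) agree after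
  restriction to SOME common open subgroup (induction over the generated equivalence relation, using
  functoriality `res_comp` of the restriction maps);
* `ModelMLFGaloisData.kummerLim_injective` — injectivity of `𝒪_k̄^⊳ → lim→_J H¹(J, Λ(k̄ˣ))` for open `ε_k`.

HONEST FRAMING: OUR kernel check of classical Kummer theory; nothing here bears on [IUTchIII] Cor. 3.12.
-/

noncomputable section

namespace Literature.AnabelianGeometry.AbsoluteAnabelian

universe u

/-! ### Agreement in the direct limit `lim→_J H¹(J, ·)` -/

namespace ContCohomologyData

variable {P : Type u} [Group P] [TopologicalSpace P] (C : ContCohomologyData P)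

/-- Two representatives define the same element of `lim→_J H¹(J, ·)` (the quotient `H1Lim`) only if
they agree after restriction to some common open subgroup.  (The defining relation is reflexive and
symmetric; closing it under transitivity uses `res_comp` and the intersection of open subgroups.)
[cite: MochizukiAbsTopIII2015, Proposition 3.2 (ii) p.71] -/
theorem H1Lim.agree_of_eq {a b : Σ J : OpenSubgroup P, C.H1 J}
    (h : (Quot.mk _ a : C.H1Lim) = Quot.mk _ b) :
    ∃ (L : OpenSubgroup P) (ha : L ≤ a.1) (hb : L ≤ b.1), C.res ha a.2 = C.res hb b.2 := by
  have key : Relation.EqvGen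
      (fun a b : (Σ J : OpenSubgroup P, C.H1 J) =>
        ∃ (L : OpenSubgroup P) (ha : L ≤ a.1) (hb : L ≤ b.1), C.res ha a.2 = C.res hb b.2) a b :=
    Quot.eqvGen_exact h
  clear h
  induction key with
  | rel x y hxy => exact hxy
  | refl x => exact ⟨x.1, le_rfl, le_rfl, rfl⟩
  | symm x y _ ih =>
    obtain ⟨L, hx, hy, hL⟩ := ih
    exact ⟨L, hy, hx, hL.symm⟩
  | trans x y z _ _ ih₁ ih₂ =>
    obtain ⟨L₁, hx, hy₁, h₁⟩ := ih₁
    obtain ⟨L₂, hy₂, hz, h₂⟩ := ih₂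
    refine ⟨L₁ ⊓ L₂, inf_le_left.trans hx, inf_le_right.trans hz, ?_⟩
    have e₁ := congrArg (C.res (inf_le_left : L₁ ⊓ L₂ ≤ L₁)) h₁
    have e₂ := congrArg (C.res (inf_le_right : L₁ ⊓ L₂ ≤ L₂)) h₂
    rw [← AddMonoidHom.comp_apply, ← C.res_comp, ← AddMonoidHom.comp_apply, ← C.res_comp] at e₁ e₂
    exact e₁.trans e₂

end ContCohomologyData

/-! ### Injectivity of `𝒪_k̄^⊳ → lim→_J H¹(J, Λ(k̄ˣ))` -/

namespace ModelMLFGaloisData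

variable (C : MLFClosure.{0}) (D : ModelMLFGaloisData C.k C.K)

/-- **The Kummer map `𝒪_k̄^⊳ → lim→_J H¹(J, Λ(k̄ˣ))` of the model is injective** when `ε_k : Π_k ↠ G_k` is
an open map: equal classes agree at some common open level `L` (`H1Lim.agree_of_eq`), where both are the
level-`L` Kummer classes (`kummer_res`), and the level-`L` Kummer map is injective
(`kummer_injective`). [cite: MochizukiAbsTopIII2015, Proposition 3.2 (ii) p.71] -/
theorem kummerLim_injective (hε : IsOpenMap D.aug) :
    Function.Injective (D.kummerTheory C).kummerLim := by
  intro m m' h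
  have hm := (D.kummerTheory C).kummerLim_spec m (D.stabilizerOpen C m)
    (fun g => (D.mem_stabilizerOpen_iff C m g).mp g.2)
  have hm' := (D.kummerTheory C).kummerLim_spec m' (D.stabilizerOpen C m')
    (fun g => (D.mem_stabilizerOpen_iff C m' g).mp g.2)
  rw [hm, hm'] at h
  obtain ⟨L, hL, hL', hres⟩ := ContCohomologyData.H1Lim.agree_of_eq _ h
  rw [(D.kummerTheory C).kummer_res hL, (D.kummerTheory C).kummer_res hL'] at hres
  exact congrArg Subtype.val (D.kummer_injective C hε L hres)

/-- In particular, two non-zero integers of `k̄` with the same Kummer class in `lim→_J H¹(J, Λ(k̄ˣ))` are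
equal — the mono-analytic / profinite case in which every open subgroup of `Π_k` has open image.
[cite: MochizukiAbsTopIII2015, Proposition 3.2 (ii) p.71] -/
theorem kummerLim_eq_iff (hε : IsOpenMap D.aug) (m m' : D.tmPair.M) :
    (D.kummerTheory C).kummerLim m = (D.kummerTheory C).kummerLim m' ↔ m = m' :=
  (D.kummerLim_injective C hε).eq_iff

end ModelMLFGaloisData

end Literature.AnabelianGeometry.AbsoluteAnabelian

end
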